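import Mathlib
import Summits.QuantumFields.BalabanUV.Beta.FP.CovarianceLoewnerSandwich
import Summits.QuantumFields.BalabanUV.Beta.FP.BlockMeanVariance
import Summits.QuantumFields.BalabanUV.Beta.GAN24.TorusAvatar
import Literature.MathematicalPhysics.QuantumFieldTheory.Balaban1983to89.Beta.OneStepKernelFamily

/-!
# Road «FP», row IR-5′ (c′) — FILE F5a: the TORUS SIDE of the m-uniform sup letter — the block-contour weight vectors of a
# field leg and the bound `|Σ_{i,i'} legW·legW·Re 𝒞(p_i, q_{i'})| ≤ γ₀⁻¹·Mb^{−(d+1)}·(d+3)³R²∕(4N²)` on every large torus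

Cell `pub-balaban`, β sub-cell, binder row D1, road «FP» (owner `b2b-balaban-beta-d1-p3`, «GO» journal
2026-08-21T10:09Z), lane (U2) IR-5′ (unit `b2b-balaban-beta-d1-formalise-leaf-05`, gen 17).  Fifth module (part a) of the
m-UNIFORM SUP LETTER of the perfect ff block (`FF-SUP-PLAN.md`; F1 `FP/CovarianceLoewnerSandwich`, F2
`FP/TorusLaplaceComparison`, F3 `FP/TorusSupersolution(Algebra)`, F4 `FP/BlockMeanVariance`).

## What this file certifies (kernel, [folklore] finite bookkeeping + the landed chain BY NAME)
* §1 GENERIC weight vectors `w(z) = Σ_{i∈S} [z = p i]·a` (finite sums of basis vectors; NO `def`): non-negativity, total mass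
  `|S|·a` (`sum_indicatorSum`), the value `= a·#fibre` (`indicatorSum_eq_card_mul`) and `≤ m·a` under a fibre bound
  (`indicatorSum_le_of_fibre`), support (`exists_of_indicatorSum_ne_zero`), and THE BILINEAR IDENTITY
  `⟨w_S, C w_T⟩ = Σ_{i∈S}Σ_{i'∈T} a·C(p i, q i')·b` (`form_indicatorSum`).
* §2 LEG GEOMETRY of an2's block-contour decimation (`OneStepKernelFamily.LegIdx∕legPt∕legW`): on a torus `Tor P` with
  `Mb ≤ P_μ` at most `Mb` contour indices of a field leg project to the same torus point (`card_fibre_le`); with `4Mb ≤ P_μ` every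
  leg point lies in the box of radius `2Mb` about `Mb•x′` in centred representatives (`abs_valMinAbs_leg_le`).
* §3 **`abs_re_doubleSum_Cov_le`** — for `3 ≤ d` (four or more directions), `1 ≤ N`, `1 ≤ Mb`, `R := 2Mb + (d+1)` and every coarse
  torus `M` with `16(d+1)N² + 10 ≤ N·M_ν`, `2R + 2 < N·M_ν`, `4Mb ≤ N·M_ν`:
  `|Σ_{i,i'∈LegIdx} legW·legW·Re 𝒞_{(toTor p_i, κ),(toTor q_{i'}, l)}| ≤ γ₀(d+1,1)⁻¹ · (Mb^{d+1})⁻¹ · (d+3)³R²∕(4N²)`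
  (`𝒞 = FluctuationProjection.Cov N _ M 1 _`; F1 `abs_re_form_Cov_le_of_bounds` + F4 `re_form_LapOne_inv_le_box` at
  `gmax = (Mb^{d+1})⁻¹`, `Σ = 1` by `sum_legW`).

HONEST SCOPE: the torus-side inequality only; the junction with an2's `Gam`∕`KTot` (g15 `CompositeCovarianceJunction`) and the
de-periodisation to `ℤ^{d+1}` are F5b.  No B5 statement beyond the KERNEL (1.90) inside F1.  0∕4 row-D1 binders; NOT hfar, NOT hRb,
NOT (ASYMP), NOT D1, NOT BetaPertH, NOT continuum, NOT Clay.  HONEST DEPENDENCY: continuum YM on T⁴ ⇐ BetaPertH ∧ nine spine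
estimates (0/9 proved); BetaPertH ⇐ (D1) ∧ (D4) ∧ CAP+tail; G-an2-4 gates asym, D1 and NE2/3/4.
-/

noncomputable section

open scoped BigOperators Matrix ComplexConjugate

namespace Summit.QuantumFields.BalabanUV.Beta.FP.PerfectFFBlockTorus

open Matrix
open Literature.MathematicalPhysics.QuantumFieldTheory.Balaban1983to89
open Literature.MathematicalPhysics.QuantumFieldTheory.Balaban1983to89.Beta
open AffineAveraging (Site)
open B5Prop11Plancherel (Tor fine)
open B5Prop11Lower (Lap)
open B5Prop11Lattice (gammaZero gammaZero_pos)
open FluctuationProjection (Cov)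
open OneStepKernelFamily (LegIdx legPt legW legSet sum_legW legW_nonneg)
open Summit.QuantumFields.BalabanUV.Beta.GAN24.TorusAvatar (toTor toTor_add toTor_sub toTor_zsmul)
open Summit.QuantumFields.BalabanUV.Beta.FP.CovarianceLoewnerSandwich (abs_re_form_Cov_le_of_bounds)
open Summit.QuantumFields.BalabanUV.Beta.FP.BlockMeanVariance (re_form_LapOne_inv_le_box)

/-! ## §1 Generic weight vectors `z ↦ Σ_{i∈S} [z = p i]·a` -/

section Generic

variable {ι α β : Type*}

/-- the value of a weight vector is `a` times the size of the fibre. [folklore] -/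
theorem indicatorSum_eq_card_mul [DecidableEq ι] [DecidableEq α] (S : Finset α) (p : α → ι) (a : ℝ) (z : ι) :
    (∑ i ∈ S, (if z = p i then a else 0)) = ((S.filter (fun i => p i = z)).card : ℝ) * a := by
  rw [Finset.card_eq_sum_ones, Nat.cast_sum, Finset.sum_mul, Finset.sum_filter]
  refine Finset.sum_congr rfl fun i _ => ?_
  by_cases h : p i = z
  · rw [if_pos h.symm, if_pos h]; simp
  · rw [if_neg (fun h' => h h'.symm), if_neg h]

/-- weight vectors with `a ≥ 0` are non-negative. [folklore] -/
theorem indicatorSum_nonneg [DecidableEq ι] (S : Finset α) (p : α → ι) {a : ℝ} (ha : 0 ≤ a) (z : ι) :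
    0 ≤ ∑ i ∈ S, (if z = p i then a else 0) :=
  Finset.sum_nonneg fun i _ => by split_ifs <;> [exact ha; exact le_rfl]

/-- total mass `|S|·a`. [folklore] -/
theorem sum_indicatorSum [Fintype ι] [DecidableEq ι] (S : Finset α) (p : α → ι) (a : ℝ) :
    ∑ z, ∑ i ∈ S, (if z = p i then a else 0) = (S.card : ℝ) * a := by
  rw [Finset.sum_comm]
  simp only [Finset.sum_ite_eq', Finset.mem_univ, if_true, Finset.sum_const, nsmul_eq_mul]

/-- sup bound from a fibre bound. [folklore] -/
theorem indicatorSum_le_of_fibre [DecidableEq ι] [DecidableEq α] (S : Finset α) (p : α → ι) {a : ℝ} (ha : 0 ≤ a) {m : ℕ}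
    (hfib : ∀ z, (S.filter (fun i => p i = z)).card ≤ m) (z : ι) :
    ∑ i ∈ S, (if z = p i then a else 0) ≤ (m : ℝ) * a := by
  rw [indicatorSum_eq_card_mul]
  exact mul_le_mul_of_nonneg_right (by exact_mod_cast hfib z) ha

/-- support: a point of non-zero weight is one of the `p i`. [folklore] -/
theorem exists_of_indicatorSum_ne_zero [DecidableEq ι] (S : Finset α) (p : α → ι) (a : ℝ) (z : ι)
    (h : ∑ i ∈ S, (if z = p i then a else 0) ≠ 0) : ∃ i ∈ S, z = p i := by
  by_contra hne
  push Not at hne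
  exact h (Finset.sum_eq_zero fun i hi => if_neg (hne i hi))

/-- `Σ_z (Σ_{i∈S} [z = p i]·a) · h z = Σ_{i∈S} a · h (p i)`. [folklore] -/
theorem sum_indicatorSum_mul [Fintype ι] [DecidableEq ι] (S : Finset α) (p : α → ι) (a : ℂ) (h : ι → ℂ) :
    ∑ z, (∑ i ∈ S, (if z = p i then a else 0)) * h z = ∑ i ∈ S, a * h (p i) := by
  simp only [Finset.sum_mul, ite_mul, zero_mul]
  rw [Finset.sum_comm]
  refine Finset.sum_congr rfl fun i _ => ?_
  rw [Finset.sum_ite_eq' Finset.univ (p i), if_pos (Finset.mem_univ _)]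

/-- `Σ_z h z · (Σ_{i∈S} [z = p i]·a) = Σ_{i∈S} h (p i) · a`. [folklore] -/
theorem sum_mul_indicatorSum [Fintype ι] [DecidableEq ι] (S : Finset α) (p : α → ι) (a : ℂ) (h : ι → ℂ) :
    ∑ z, h z * (∑ i ∈ S, (if z = p i then a else 0)) = ∑ i ∈ S, h (p i) * a := by
  simp only [Finset.mul_sum, mul_ite, mul_zero]
  rw [Finset.sum_comm]
  refine Finset.sum_congr rfl fun i _ => ?_
  rw [Finset.sum_ite_eq' Finset.univ (p i), if_pos (Finset.mem_univ _)]

/-- cast of the real weight vector. [folklore] -/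
theorem ofReal_indicatorSum [DecidableEq ι] (S : Finset α) (p : α → ι) (a : ℝ) (z : ι) :
    (((∑ i ∈ S, (if z = p i then a else 0)) : ℝ) : ℂ) = ∑ i ∈ S, (if z = p i then (a : ℂ) else 0) := by
  rw [Complex.ofReal_sum]
  exact Finset.sum_congr rfl fun i _ => by split_ifs <;> simp

/-- **THE BILINEAR IDENTITY**: `⟨w_S, C·w_T⟩ = Σ_{i∈S}Σ_{i'∈T} a·C(p i, q i')·b`. [folklore] -/
theorem form_indicatorSum [Fintype ι] [DecidableEq ι] (C : Matrix ι ι ℂ) (S : Finset α) (T : Finset β) (a b : ℝ)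
    (p : α → ι) (q : β → ι) :
    star (fun z => ((∑ i ∈ S, (if z = p i then a else 0) : ℝ) : ℂ))
        ⬝ᵥ (C *ᵥ fun z => ((∑ i' ∈ T, (if z = q i' then b else 0) : ℝ) : ℂ))
      = ∑ i ∈ S, ∑ i' ∈ T, (a : ℂ) * (C (p i) (q i') * b) := by
  have hF : star (fun z => ((∑ i ∈ S, (if z = p i then a else 0) : ℝ) : ℂ))
      = fun z => ∑ i ∈ S, (if z = p i then (a : ℂ) else 0) := by
    funext z
    rw [Pi.star_apply, Complex.star_def, Complex.conj_ofReal, ofReal_indicatorSum]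
  have hG : (fun z => ((∑ i' ∈ T, (if z = q i' then b else 0) : ℝ) : ℂ))
      = fun z => ∑ i' ∈ T, (if z = q i' then (b : ℂ) else 0) := by
    funext z; rw [ofReal_indicatorSum]
  rw [hF, hG]
  simp only [dotProduct, Matrix.mulVec]
  rw [sum_indicatorSum_mul]
  refine Finset.sum_congr rfl fun i _ => ?_
  rw [sum_mul_indicatorSum, Finset.mul_sum]

/-- real part of the bilinear identity. [folklore] -/
theorem re_form_indicatorSum [Fintype ι] [DecidableEq ι] (C : Matrix ι ι ℂ) (S : Finset α) (T : Finset β) (a b : ℝ)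
    (p : α → ι) (q : β → ι) :
    (star (fun z => ((∑ i ∈ S, (if z = p i then a else 0) : ℝ) : ℂ))
        ⬝ᵥ (C *ᵥ fun z => ((∑ i' ∈ T, (if z = q i' then b else 0) : ℝ) : ℂ))).re
      = ∑ i ∈ S, ∑ i' ∈ T, a * b * (C (p i) (q i')).re := by
  rw [form_indicatorSum, Complex.re_sum]
  refine Finset.sum_congr rfl fun i _ => ?_
  rw [Complex.re_sum]
  refine Finset.sum_congr rfl fun i' _ => ?_
  rw [Complex.re_ofReal_mul, Complex.re_mul_ofReal]
  ring

end Generic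

/-! ## §2 Leg geometry of the block-contour decimation on a torus -/

section Legs

variable {d : ℕ} (P : Fin (d + 1) → ℕ) (Mb : ℕ)

/-- the field-leg point, unfolded. [folklore] -/
theorem legPt_inl_eq (κ : Fin (d + 1)) (x' : Site (d + 1)) (i : (Fin (d + 1) → ℕ) × ℕ) :
    legPt (d := d) Mb (Sum.inl κ) x' i = (Mb : ℤ) • x' + fun j => ((i.1 j : ℤ) + if j = κ then (i.2 : ℤ) else 0) := rfl

/-- **at most `Mb` contour indices of a field leg project to the same torus point** (`Mb ≤ P_μ`): the contour step `s`
determines the index within a fibre. [folklore] -/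
theorem card_fibre_le (hMbP : ∀ μ, Mb ≤ P μ) (κ : Fin (d + 1)) (x' : Site (d + 1)) (z : Tor P × Fin (d + 1)) :
    ((LegIdx d Mb).filter (fun i => (toTor P (legPt (d := d) Mb (Sum.inl κ) x' i), κ) = z)).card ≤ Mb := by
  classical
  calc ((LegIdx d Mb).filter (fun i => (toTor P (legPt (d := d) Mb (Sum.inl κ) x' i), κ) = z)).card
      ≤ (Finset.range Mb).card := by
        refine Finset.card_le_card_of_injOn (fun i => i.2) (fun i hi => ?_) ?_
        · have hi' := (Finset.mem_filter.mp hi).1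
          simp only [LegIdx, Finset.mem_product, Finset.mem_coe] at hi' ⊢
          exact hi'.2
        · intro i hi i' hi' hs
          have hi1 := (Finset.mem_filter.mp (Finset.mem_coe.mp hi)).1
          have hi2 := (Finset.mem_filter.mp (Finset.mem_coe.mp hi)).2
          have hi'1 := (Finset.mem_filter.mp (Finset.mem_coe.mp hi')).1
          have hi'2 := (Finset.mem_filter.mp (Finset.mem_coe.mp hi')).2
          simp only [LegIdx, Finset.mem_product, Fintype.mem_piFinset, Finset.mem_range] at hi1 hi'1
          have heq : toTor P (legPt (d := d) Mb (Sum.inl κ) x' i) = toTor P (legPt (d := d) Mb (Sum.inl κ) x' i') :=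
            (Prod.ext_iff.mp hi2).1.trans (Prod.ext_iff.mp hi'2).1.symm
          refine Prod.ext (funext fun μ => ?_) hs
          have hμ := congrFun heq μ
          simp only [toTor, legPt_inl_eq, Pi.add_apply, Pi.smul_apply, smul_eq_mul, Int.cast_add, Int.cast_mul,
            Int.cast_natCast] at hμ
          have hs' : (i.2 : ℤ) = i'.2 := by exact_mod_cast hs
          have hμ' : (((i.1 μ : ℕ) : ℤ) : ZMod (P μ)) = (((i'.1 μ : ℕ) : ℤ) : ZMod (P μ)) := by
            have := hμ
            rw [hs'] at this
            simpa using this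
          -- residues of naturals below `P μ` determine them (as in `GAN24.TaylorMassLam.nat_eq_of_zmod_eq`)
          rw [Int.cast_natCast, Int.cast_natCast] at hμ'
          have h2 := (ZMod.natCast_eq_natCast_iff' (i.1 μ) (i'.1 μ) (P μ)).1 hμ'
          rwa [Nat.mod_eq_of_lt ((hi1.1 μ).trans_le (hMbP μ)), Nat.mod_eq_of_lt ((hi'1.1 μ).trans_le (hMbP μ))] at h2
    _ = Mb := Finset.card_range Mb

/-- **every leg point of a field leg lies in the box of radius `2Mb` about `Mb•x′`** (centred representatives, `4Mb ≤ P_μ`).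
[folklore] -/
theorem abs_valMinAbs_leg_le (hMbP : ∀ μ, 4 * Mb ≤ P μ) (κ : Fin (d + 1)) (x' : Site (d + 1))
    {i : (Fin (d + 1) → ℕ) × ℕ} (hi : i ∈ LegIdx d Mb) (μ : Fin (d + 1)) :
    |(((toTor P (legPt (d := d) Mb (Sum.inl κ) x' i) - toTor P ((Mb : ℤ) • x')) μ).valMinAbs : ℝ)| ≤ 2 * Mb := by
  simp only [LegIdx, Finset.mem_product, Fintype.mem_piFinset, Finset.mem_range] at hi
  rw [legPt_inl_eq, toTor_add, add_sub_cancel_left]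
  set v : ℕ := i.1 μ + (if μ = κ then i.2 else 0) with hv
  have hvle : v ≤ 2 * Mb := by
    rw [hv]; split_ifs
    · have := hi.1 μ; have := hi.2; omega
    · have := hi.1 μ; omega
  have hcoord : (toTor P (fun j => ((i.1 j : ℤ) + if j = κ then (i.2 : ℤ) else 0))) μ = ((v : ℕ) : ZMod (P μ)) := by
    simp only [toTor, hv]
    push_cast
    split_ifs <;> simp
  rw [hcoord, ZMod.valMinAbs_natCast_of_le_half (by have := hMbP μ; omega)]
  rw [Int.cast_natCast, Nat.abs_cast]
  exact_mod_cast hvle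

end Legs

/-! ## §3 The torus-side bound for the block-contour double sum of `Re 𝒞` -/

section TorusBound

variable {d : ℕ} (N : ℕ) [NeZero N] (hN : 1 ≤ N) (M : Fin (d + 1) → ℕ) [hM : ∀ ν, NeZero (M ν)] (Mb : ℕ)

/-- **THE TORUS-SIDE BOUND**: for `3 ≤ d`, `1 ≤ Mb`, `R = 2Mb + (d+1)` and every large coarse torus `M`,
`|Σ_{i,i'∈LegIdx} legW·legW·Re 𝒞_{(toTor p_i, κ),(toTor q_{i'}, l)}| ≤ γ₀(d+1,1)⁻¹·(Mb^{d+1})⁻¹·((d+3)³·R²∕(4N²))`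
— F1's off-diagonal Löwner bound fed with F4's block-weight variance bound for the two block-contour weight vectors
(mass `1` by `sum_legW`, sup `≤ (Mb^{d+1})⁻¹` by `card_fibre_le`, box radius `2Mb ≤ R` by `abs_valMinAbs_leg_le`). [folklore] -/
theorem abs_re_doubleSum_Cov_le (hd : 3 ≤ d) (hMb : 1 ≤ Mb)
    (hPt : ∀ ν, 16 * ((d + 1 : ℕ) : ℝ) * (N : ℝ) ^ 2 + 10 ≤ ((N * M ν : ℕ) : ℝ))
    (hPR : ∀ ν, 2 * (2 * (Mb : ℝ) + ((d + 1 : ℕ) : ℝ)) + 2 < ((N * M ν : ℕ) : ℝ))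
    (hP4 : ∀ ν, 4 * Mb ≤ N * M ν)
    (x' y' : Site (d + 1)) (κ l : Fin (d + 1)) :
    |∑ i ∈ LegIdx d Mb, ∑ i' ∈ LegIdx d Mb, legW d Mb (Sum.inl κ : OneStepResolventKernel.Fib d) * legW d Mb (Sum.inl l : OneStepResolventKernel.Fib d) *
        (Cov N hN M 1 one_pos (toTor (fine N M) (legPt (d := d) Mb (Sum.inl κ) x' i), κ)
          (toTor (fine N M) (legPt (d := d) Mb (Sum.inl l) y' i'), l)).re|
      ≤ (gammaZero (d + 1) 1)⁻¹ *
          (1 * ((((Mb : ℝ) ^ (d + 1))⁻¹) * ((((d + 1 : ℕ) : ℝ) + 2) ^ 3 * (2 * (Mb : ℝ) + ((d + 1 : ℕ) : ℝ)) ^ 2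
            / (4 * (N : ℝ) ^ 2)))) := by
  classical
  -- abbreviations
  set P : Fin (d + 1) → ℕ := fine N M with hPdef
  set a : ℝ := legW d Mb (Sum.inl κ : OneStepResolventKernel.Fib d) with hadef
  set b : ℝ := legW d Mb (Sum.inl l : OneStepResolventKernel.Fib d) with hbdef
  have hab : a = b := by rw [hadef, hbdef]; rfl
  have ha_eq : a = (((Mb : ℝ) ^ (d + 2)))⁻¹ := by rw [hadef]; rfl
  have ha0 : 0 ≤ a := legW_nonneg Mb _
  set R : ℝ := 2 * (Mb : ℝ) + ((d + 1 : ℕ) : ℝ) with hRdef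
  set p : ((Fin (d + 1) → ℕ) × ℕ) → Tor P × Fin (d + 1) := fun i => (toTor P (legPt (d := d) Mb (Sum.inl κ) x' i), κ) with hp
  set q : ((Fin (d + 1) → ℕ) × ℕ) → Tor P × Fin (d + 1) := fun i => (toTor P (legPt (d := d) Mb (Sum.inl l) y' i), l) with hq
  set F : Tor P × Fin (d + 1) → ℝ := fun z => ∑ i ∈ LegIdx d Mb, (if z = p i then a else 0) with hFdef
  set G : Tor P × Fin (d + 1) → ℝ := fun z => ∑ i ∈ LegIdx d Mb, (if z = q i then b else 0) with hGdef
  -- the double sum is the form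
  have hform := re_form_indicatorSum (Cov N hN M 1 one_pos) (LegIdx d Mb) (LegIdx d Mb) a b p q
  -- hypotheses of F4, common data
  have hD : 4 ≤ d + 1 := by omega
  have hMb1 : (1 : ℝ) ≤ Mb := by exact_mod_cast hMb
  have hdpos : (0 : ℝ) ≤ ((d + 1 : ℕ) : ℝ) := by positivity
  have hR2 : (((d + 1 : ℕ) : ℝ)) + 2 ≤ R ^ 2 := by
    have hR3 : ((d + 1 : ℕ) : ℝ) + 2 ≤ R := by rw [hRdef]; linarith
    have hR1 : 1 ≤ R := by linarith
    nlinarith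
  have hR4 : 4 ≤ R ^ 2 := by
    have h2 : 2 ≤ R := by rw [hRdef]; linarith
    nlinarith
  have hgmax_eq : (Mb : ℝ) * a = ((Mb : ℝ) ^ (d + 1))⁻¹ := by
    rw [ha_eq, pow_succ, mul_inv, ← mul_assoc, mul_comm (Mb : ℝ), mul_assoc, mul_inv_cancel₀ (by positivity), mul_one]
  have hMbP : ∀ μ, Mb ≤ P μ := fun μ => le_trans (by omega) (hP4 μ)
  -- the variance bound for a weight vector of this shape (both `F` and `G` are instances)
  have hvar : ∀ (κ₀ : Fin (d + 1)) (x₀ : Site (d + 1)),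
      (star (fun j => ((( ∑ i ∈ LegIdx d Mb, (if j = (toTor P (legPt (d := d) Mb (Sum.inl κ₀) x₀ i), κ₀) then a else 0)) : ℝ) : ℂ))
        ⬝ᵥ ((Lap N M + 1)⁻¹ *ᵥ fun j => (((∑ i ∈ LegIdx d Mb,
            (if j = (toTor P (legPt (d := d) Mb (Sum.inl κ₀) x₀ i), κ₀) then a else 0)) : ℝ) : ℂ))).re
        ≤ 1 * (((Mb : ℝ) ^ (d + 1))⁻¹ * ((((d + 1 : ℕ) : ℝ) + 2) ^ 3 * R ^ 2 / (4 * (N : ℝ) ^ 2))) := by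
    intro κ₀ x₀
    set p₀ : ((Fin (d + 1) → ℕ) × ℕ) → Tor P × Fin (d + 1) :=
      fun i => (toTor P (legPt (d := d) Mb (Sum.inl κ₀) x₀ i), κ₀) with hp₀
    set g : Tor P × Fin (d + 1) → ℝ := fun j => ∑ i ∈ LegIdx d Mb, (if j = p₀ i then a else 0) with hg
    have hg0 : ∀ j, 0 ≤ g j := fun j => indicatorSum_nonneg _ _ ha0 j
    have hgmax : ∀ j, g j ≤ ((Mb : ℝ) ^ (d + 1))⁻¹ := fun j => by
      rw [← hgmax_eq]
      exact indicatorSum_le_of_fibre (LegIdx d Mb) p₀ ha0 (card_fibre_le P Mb hMbP κ₀ x₀) j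
    have hsupp : ∀ x μ, g (x, μ) ≠ 0 → ∀ ν, |(((x - toTor P ((Mb : ℤ) • x₀)) ν).valMinAbs : ℝ)| ≤ R := by
      intro x μ hx ν
      obtain ⟨i, hi, hxi⟩ := exists_of_indicatorSum_ne_zero (LegIdx d Mb) p₀ a (x, μ) hx
      have hx' : x = toTor P (legPt (d := d) Mb (Sum.inl κ₀) x₀ i) := (Prod.ext_iff.mp hxi).1
      rw [hx']
      exact (abs_valMinAbs_leg_le P Mb hP4 κ₀ x₀ hi ν).trans (by rw [hRdef]; linarith)
    have hsum : ∑ j, g j = 1 := by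
      rw [hg, sum_indicatorSum, hadef]
      have := sum_legW (d := d) (M := Mb) (by omega) (Sum.inl κ₀)
      rw [legSet, Finset.sum_const, nsmul_eq_mul] at this
      exact this
    have h := re_form_LapOne_inv_le_box N M hD R hR2 hR4 hPt hPR (toTor P ((Mb : ℤ) • x₀)) g
      (((Mb : ℝ) ^ (d + 1))⁻¹) hg0 hgmax hsupp
    rw [hsum] at h
    exact h
  have hf := hvar κ x'
  have hg' := hvar l y'
  rw [← hab] at hGdef
  have key := abs_re_form_Cov_le_of_bounds N hN M 1 one_pos (fun j => ((F j : ℝ) : ℂ)) (fun j => ((G j : ℝ) : ℂ)) hf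
    (by rw [hGdef]; exact hg')
  rw [hFdef, hGdef, re_form_indicatorSum] at key
  -- identify the double sum (with `a = b`)
  have e : ∑ i ∈ LegIdx d Mb, ∑ i' ∈ LegIdx d Mb, a * b * (Cov N hN M 1 one_pos (p i) (q i')).re
      = ∑ i ∈ LegIdx d Mb, ∑ i' ∈ LegIdx d Mb, a * a * (Cov N hN M 1 one_pos (p i) (q i')).re := by rw [hab]
  rw [e]
  exact key

end TorusBound

end Summit.QuantumFields.BalabanUV.Beta.FP.PerfectFFBlockTorus
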